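/-
Copyright (c) 2026 the pub-hodgecm-mathlib formalisation cell (harness21).  Prover seat hodgecm-mathlib-K2E4-p14 (g7), Track B ∕ K2-LIT, h413 =
`stmt-HodgeConjecture-24833`, line `K2_E1_TraceFormulaBeta`, road (ρ2) «G7 PROPER», file (R-b) (dealer K2E1-plan (g5), RULING «(ρ2b) = G7 PROPER» 2026-09-04T08:48:57Z (2),
DEAL 08:53:27Z): the `(σ, g)`-UNIFORM majorant of `(σ − 1)·E(φ₀H^σ)(g)`, `σ ∈ (1, 1 + η]`, that the dominated-convergence file (R-c) consumes.
-/
import Summits.HodgeConjecture.HodgeConjecture.Theorems.K2E1SphericalEisensteinContinuationU2Final   -- ★ p858453 (K2E4-p14 g6): `borelConstantTerm_sphericalEisenstein_cm_two`; brings ★ W5-B, ★ Godement CM-two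
import Summits.HodgeConjecture.HodgeConjecture.Theorems.K2E1BLReductionCoveringU2                 -- ★ BL-R1 p858699∕p858727 (K2E1-p08 g6): `exists_reduction_ray_cm`, `w₁`, `exists_pos_forall_lt_ciSup_borelHeight_mul_cm`
import Summits.HodgeConjecture.HodgeConjecture.Theorems.K2E1BorelEisensteinRegularU                -- ★ `continuous_eisensteinSeriesU_flatSectionU_cm_two`
import Summits.HodgeConjecture.HodgeConjecture.Theorems.K2E1BorelEisensteinGodementU               -- ★ (G) smear `exists_smear_borelHeight`
import Literature.NumberTheory.Automorphic.UnitaryGroupBorelSiegelSetStructureTwo                  -- ★ (R2) torus contraction on the line `exists_isCompact_torusConj_mem_two`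
import Literature.NumberTheory.Automorphic.IdeleClassGroupAutomorphicQuotientProofs               -- ★ `continuous_realToInfiniteAdele`
import HarnessLib

/-!
# K2·E1 — `K2E1ResidueUniformMajorantCMTwo` (road (ρ2) «G7 PROPER», file (R-b)): THE `(σ, g)`-UNIFORM MAJORANT
# `(σ − 1)·‖E(φ₀H^σ)(g)‖ ≤ C·w₁(g)^A` FOR `σ ∈ (1, 1 + η]` OF THE SPHERICAL EISENSTEIN SERIES OF `U(1,1)_{L∕L⁺}`

Track B ∕ K2-LIT, crux h413 = `stmt-HodgeConjecture-24833`, route of record `HCCMUnconditional`; cell `hodgecm-mathlib`, squad K2, ENGINE E1.  Prover seat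
`hodgecm-mathlib-K2E4-p14` (g7).  THEOREMS ONLY (no `def`, no `instance`, no notation, no named-fact hypothesis, no `sorry`); lane `--supports stmt-HodgeConjecture-24833
--as helper` (count-neutral).  Closes no socket.

THE POINT.  (R-c) `K2E1CuspFormsMeanZeroDecayingCMTwo` proves `∫_X φ dμ = 0` for decaying cusp forms by dominated convergence along REAL `σ → 1⁺`:
`⟨(σ−1)E(φ₀H^σ), φ⟩ = 0` for `σ > 1` (★ P7 FILE A) while `(σ−1)E(φ₀H^σ)(g) → φ₀·r ≠ 0` pointwise (★ capstone p858603).  It needs ONE majorant of `(σ−1)·E(φ₀H^σ)(g)`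
uniform in `σ ∈ (1, 1+η]` AND in `g`, of polynomial growth in the height.  On that interval the series CONVERGES, so no continuation enters; and for real `σ` the
spherical section is POSITIVE: `E(φ₀H^σ) = φ₀·E(H^σ)`, `E(H^σ)(g) = Σ_{q ∈ B(F)∖G(F)} H(γ̃_q g)^σ ≥ 0` termwise.  ROAD (positivity + reduction theory, every input ★):
reduce `g` by ★ BL-R1 `exists_reduction_ray_cm` (`γ₀ g = t·k`, `k ∈ Kq` compact, `t = d(z_L(r), z_L(r)⁻¹)`, `r ≥ r₀`) and automorphy ★ `eisensteinSeriesU_flatSectionU_rational_mul`;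
for `u` in the compact closure `𝓕̄` of the fundamental domain of `N(L⁺)∖N(𝔸)`, `t k = (u t)·c` with `c = (t⁻¹ u t)⁻¹ k` in ONE compact set (★ (R2) torus contraction
`exists_isCompact_torusConj_mem_two`, the root value `z_L(r)⁻²` staying in the compact `z_L([0, r₀⁻²]) ⊆ 𝔸_L`), so `H(x·t k) ≤ A·H(x·u t)` for all `x` (★ smear
`exists_smear_borelHeight`) and `E(H^σ)(t k) ≤ A^σ·E(H^σ)(u t)` for EVERY `u ∈ 𝓕`; averaging over `𝓕`: **`E(H^σ)(γ₀ g) ≤ A^σ·E(H^σ)_B(t) = A^σ·(H(t)^σ + c(σ)·H(t)^{1−σ})`**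
(★ p858453 §1 + ★ W5-B's `c`), and `(σ − 1)·` kills the only pole: `(σ−1)c(σ)` is bounded near `σ = 1` (★ W5-B: `(z−1)c(z) → r`).  With `H(t) ≥ r₀^{[L:ℚ]}H(1) > 0`,
`H(t) ≤ A·H(γ₀ g) ≤ A·w₁(g)` (`w₁ = sup_γ H(γ·)`, ★ `borelHeight_mul_le_ciSup`) and `w₁ ≥ c₀ > 0` (★), the bound `C·w₁(g)^A` follows for every exponent `A > 1`.
* §1 scalar lemmas: `exists_pos_forall_sub_one_mul_norm_le` (`(σ−1)‖c(σ)‖ ≤ ‖r‖ + 1` near `1⁺`), `rpow_le_one_add_rpow`, `rpow_le_const_mul_rpow`, `rpow_one_sub_le`, and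
  the bookkeeping inequality `residue_majorant_arith`.
* §2 the spherical series at real exponent: `eisensteinSeriesU_flatSectionU_const`, `eisensteinSeriesU_flatSectionU_one_ofReal` (`E(H^σ) = ↑Σ_q H(γ̃_q g)^σ`),
  `norm_eisensteinSeriesU_flatSectionU_const_ofReal`, `tsum_borelHeight_rpow_le_of_smear` (`E(H^σ)(g) ≤ A^σ E(H^σ)(g')` from `H(x g) ≤ A H(x g')`),
  **`tsum_borelHeight_rpow_le_of_borelConstantTerm`** (`E(H^σ)(g) ≤ A^σ·(H(t)^σ + ‖c(σ)‖·H(t)^{1−σ})` from the smear towards the fibre `𝓕·t`).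
* §3 the compact smearing set of the ray: `isCompact_rootValueSegment`, `exists_isCompact_smear_set_ray`.
* §4 HEAD **`residue_uniform_majorant_cm_two`**: for `δ ∈ L⁻∖0`, a Haar measure `ν` of `N(𝔸)`, a fundamental domain `𝓕` of `N(L⁺)` with compact closure (the capstone's binders),
  `φ₀ : ℂ` and ANY exponent `A > 1`: `∃ η > 0, ∃ C ≥ 0, ∀ σ ∈ (1, 1+η], ∀ g, (σ−1)·‖E(φ₀H^σ)(g)‖ ≤ C·(⨆_γ H(γ g))^A`; corollaries `…_le_max` (`≤ C·max(H(g), H(g)⁻¹)^A`,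
  all `g`) and `…_siegel` (`≤ C·H(g)^A` on `{1 ≤ H}`) — the Siegel-set form of the deal.
HONEST LABEL: HC_CM is proved only modulo the 7 printed citations (2 remaining named inputs: hLiu418 = `stmt-HodgeConjecture-24832`, h413 = `stmt-HodgeConjecture-24833`) until rung 0
closes; this file asserts no named fact and closes no socket; its hypotheses are data choices (`δ`, `ν`, `𝓕`, Borel structures), not letters.
References: [MoeglinWaldspurger1995] I.2.2, II.1.5, IV.1.9 · [Garrett2018] §2.2–§2.3, §2.8, §3.10 · [Godement1964] §8 · [GetzHahn2024] Thm. 2.7.2 · [Rogawski1990] §2.2.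
-/

set_option autoImplicit false
-- the mandated namespace repeats the single-problem summit's segment (`HodgeConjecture.HodgeConjecture`)
set_option linter.dupNamespace false

noncomputable section

open MeasureTheory Measure NumberField IsDedekindDomain Set Filter Module MulAction
open scoped ENNReal NNReal Topology Classical Pointwise
open Literature.NumberTheory.Automorphic Literature.NumberTheory.Automorphic.UnitaryGroup AdelicGroupData
open Summit.HodgeConjecture.HodgeConjecture.Cruxes.H413.K2E1BorelEisensteinU
open Summit.HodgeConjecture.HodgeConjecture.Cruxes.H413.K2E1SphericalConstantTermContinuationU2 (sphericalConstantTerm_continuation)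
open Summit.HodgeConjecture.HodgeConjecture.Cruxes.H413.K2E1SphericalEisensteinContinuationU2Final (borelConstantTerm_sphericalEisenstein_cm_two)
open Summit.HodgeConjecture.HodgeConjecture.Cruxes.H413.K2E1BorelEisensteinGodementCMTwo (summable_borelHeight_rpow_cm_two)
open Summit.HodgeConjecture.HodgeConjecture.Cruxes.H413.K2E1BorelEisensteinRegularU (continuous_eisensteinSeriesU_flatSectionU_cm_two)
open Summit.HodgeConjecture.HodgeConjecture.Cruxes.H413.K2E1BorelEisensteinGodementU (exists_smear_borelHeight borelHeight_toAdelic_mul_le_max_two)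
open Summit.HodgeConjecture.HodgeConjecture.Cruxes.H413.K2E1BLHeightCosetsU2 (borelHeight_mul_le_ciSup bddAbove_range_borelHeight_mul borelHeight_le_ciSup ciSup_borelHeight_mul_pos)
open Summit.HodgeConjecture.HodgeConjecture.Cruxes.H413.K2E1BLReductionCoveringU2 (exists_reduction_ray_cm exists_pos_forall_lt_ciSup_borelHeight_mul_cm)

namespace Summit.HodgeConjecture.HodgeConjecture.Cruxes.H413.K2E1ResidueUniformMajorantCMTwo

/-! ## §1 Scalar lemmas -/

/-- If `(z − 1)·c(z) → r` as `z → 1` (`z ≠ 1`) then `(σ − 1)·‖c(σ)‖ ≤ ‖r‖ + 1` for real `σ ∈ (1, 1 + η)`, some `η > 0`. [folklore] -/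
theorem exists_pos_forall_sub_one_mul_norm_le {c : ℂ → ℂ} {r : ℂ} (hc : Tendsto (fun z : ℂ => (z - 1) * c z) (𝓝[≠] 1) (𝓝 r)) :
    ∃ η : ℝ, 0 < η ∧ ∀ σ : ℝ, 1 < σ → σ < 1 + η → (σ - 1) * ‖c σ‖ ≤ ‖r‖ + 1 := by
  have h1 : ∀ᶠ z : ℂ in 𝓝[≠] 1, ‖(z - 1) * c z‖ < ‖r‖ + 1 := hc.norm.eventually (Iio_mem_nhds (lt_add_one ‖r‖))
  obtain ⟨ε, hε, h⟩ := Metric.eventually_nhds_iff.1 (eventually_nhdsWithin_iff.1 h1)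
  refine ⟨ε, hε, fun σ hσ hσε => ?_⟩
  have hsub : (σ : ℂ) - 1 = ((σ - 1 : ℝ) : ℂ) := by push_cast; ring
  have hne : (σ : ℂ) ≠ 1 := fun h' => hσ.ne' (by exact_mod_cast h')
  have hdist : dist (σ : ℂ) 1 < ε := by
    rw [dist_eq_norm, hsub, Complex.norm_real, Real.norm_eq_abs, abs_of_pos (sub_pos.2 hσ)]
    linarith
  have h2 : ‖((σ : ℂ) - 1) * c σ‖ < ‖r‖ + 1 := h hdist hne
  rw [norm_mul, hsub, Complex.norm_real, Real.norm_eq_abs, abs_of_pos (sub_pos.2 hσ)] at h2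
  exact h2.le

/-- `X^s ≤ 1 + X^a` for `0 ≤ X`, `0 ≤ s ≤ a` (split at `X = 1`). [folklore] -/
theorem rpow_le_one_add_rpow {X s a : ℝ} (hX : 0 ≤ X) (hs : 0 ≤ s) (hsa : s ≤ a) : X ^ s ≤ 1 + X ^ a := by
  rcases le_total X 1 with h | h
  · exact (Real.rpow_le_one hX h hs).trans (le_add_of_nonneg_right (Real.rpow_nonneg hX a))
  · exact (Real.rpow_le_rpow_of_exponent_le h hsa).trans (le_add_of_nonneg_left zero_le_one)

/-- `X^s ≤ (1 + x₀⁻ᵃ)·X^a` for `0 < x₀ ≤ X`, `0 ≤ s ≤ a`. [folklore] -/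
theorem rpow_le_const_mul_rpow {X x₀ s a : ℝ} (hx₀ : 0 < x₀) (hX : x₀ ≤ X) (hs : 0 ≤ s) (hsa : s ≤ a) :
    X ^ s ≤ (1 + x₀⁻¹ ^ a) * X ^ a := by
  have hX0 : 0 ≤ X := hx₀.le.trans hX
  have ha : 0 ≤ a := hs.trans hsa
  have h1 : (1 : ℝ) ≤ x₀⁻¹ ^ a * X ^ a := by
    rw [← Real.mul_rpow (inv_nonneg.2 hx₀.le) hX0]
    exact Real.one_le_rpow ((one_le_inv_mul₀ hx₀).2 hX) ha
  calc X ^ s ≤ 1 + X ^ a := rpow_le_one_add_rpow hX0 hs hsa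
    _ ≤ x₀⁻¹ ^ a * X ^ a + X ^ a := add_le_add h1 le_rfl
    _ = (1 + x₀⁻¹ ^ a) * X ^ a := by ring

/-- `X^{1−σ} ≤ 1 + h₀^{−η}` for `0 < h₀ ≤ X`, `1 ≤ σ ≤ 1 + η`. [folklore] -/
theorem rpow_one_sub_le {X h₀ σ η : ℝ} (hh₀ : 0 < h₀) (hX : h₀ ≤ X) (hσ : 1 ≤ σ) (hση : σ ≤ 1 + η) :
    X ^ (1 - σ) ≤ 1 + h₀⁻¹ ^ η := by
  have hX0 : 0 < X := hh₀.trans_le hX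
  rw [show (1 - σ) = -(σ - 1) by ring, Real.rpow_neg hX0.le, ← Real.inv_rpow hX0.le]
  calc X⁻¹ ^ (σ - 1) ≤ 1 + X⁻¹ ^ η := rpow_le_one_add_rpow (inv_nonneg.2 hX0.le) (sub_nonneg.2 hσ) (by linarith)
    _ ≤ 1 + h₀⁻¹ ^ η := add_le_add le_rfl (Real.rpow_le_rpow (inv_nonneg.2 hX0.le) (inv_anti₀ hh₀ hX) (by linarith))

/-- **The bookkeeping inequality.**  If `1 < σ ≤ 1 + η ≤ a`, `1 ≤ A`, `0 < h₀ ≤ H ≤ A·w`, `0 < c₁ ≤ w`, `(σ−1)·n ≤ M` (`n ≥ 0`) and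
`S ≤ A^σ·(H^σ + n·H^{1−σ})`, then `(σ − 1)·S ≤ K·w^a` with the explicit `K = A^a·(η·(1 + (A c₁)^{−a})·A^a + M·(1 + h₀^{−η})·c₁^{−a})`. [folklore] -/
theorem residue_majorant_arith {σ η a A M h₀ c₁ H w n S : ℝ} (hσ : 1 < σ) (hση : σ ≤ 1 + η) (hηa : 1 + η ≤ a) (hA : 1 ≤ A)
    (hh₀ : 0 < h₀) (hHt : h₀ ≤ H) (hHw : H ≤ A * w) (hc₁ : 0 < c₁) (hw : c₁ ≤ w) (hn : 0 ≤ n) (hM : (σ - 1) * n ≤ M)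
    (hS : S ≤ A ^ σ * (H ^ σ + n * H ^ (1 - σ))) :
    (σ - 1) * S ≤ A ^ a * (η * (1 + (A * c₁)⁻¹ ^ a) * A ^ a + M * (1 + h₀⁻¹ ^ η) * c₁⁻¹ ^ a) * w ^ a := by
  have hw0 : 0 < w := hc₁.trans_le hw
  have hH0 : 0 < H := hh₀.trans_le hHt
  have hη0 : 0 ≤ η := by linarith
  have ha0 : 0 ≤ a := by linarith
  have hσa : σ ≤ a := hση.trans hηa
  have hA0 : 0 < A := zero_lt_one.trans_le hA
  have hAσ : A ^ σ ≤ A ^ a := Real.rpow_le_rpow_of_exponent_le hA hσa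
  have hx₀ : 0 < A * c₁ := mul_pos hA0 hc₁
  have h1 : H ^ σ ≤ (1 + (A * c₁)⁻¹ ^ a) * (A ^ a * w ^ a) := by
    rw [← Real.mul_rpow hA0.le hw0.le]
    calc H ^ σ ≤ (A * w) ^ σ := Real.rpow_le_rpow hH0.le hHw (by linarith)
      _ ≤ _ := rpow_le_const_mul_rpow hx₀ (mul_le_mul_of_nonneg_left hw hA0.le) (by linarith) hσa
  have h2 : H ^ (1 - σ) ≤ 1 + h₀⁻¹ ^ η := rpow_one_sub_le hh₀ hHt hσ.le hση
  have h3 : (1 : ℝ) ≤ c₁⁻¹ ^ a * w ^ a := by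
    rw [← Real.mul_rpow (inv_nonneg.2 hc₁.le) hw0.le]
    exact Real.one_le_rpow ((one_le_inv_mul₀ hc₁).2 hw) ha0
  have hM0 : 0 ≤ M := le_trans (mul_nonneg (by linarith) hn) hM
  have hK2 : 0 ≤ 1 + h₀⁻¹ ^ η := by positivity
  have hsum : (σ - 1) * H ^ σ + (σ - 1) * n * H ^ (1 - σ) ≤ η * ((1 + (A * c₁)⁻¹ ^ a) * (A ^ a * w ^ a)) + M * (1 + h₀⁻¹ ^ η) :=
    add_le_add (mul_le_mul (by linarith) h1 (Real.rpow_nonneg hH0.le _) hη0) (mul_le_mul hM h2 (Real.rpow_nonneg hH0.le _) hM0)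
  have hsum0 : 0 ≤ (σ - 1) * H ^ σ + (σ - 1) * n * H ^ (1 - σ) :=
    add_nonneg (mul_nonneg (by linarith) (Real.rpow_nonneg hH0.le _)) (mul_nonneg (mul_nonneg (by linarith) hn) (Real.rpow_nonneg hH0.le _))
  calc (σ - 1) * S ≤ (σ - 1) * (A ^ σ * (H ^ σ + n * H ^ (1 - σ))) := mul_le_mul_of_nonneg_left hS (by linarith)
    _ = A ^ σ * ((σ - 1) * H ^ σ + (σ - 1) * n * H ^ (1 - σ)) := by ring
    _ ≤ A ^ a * (η * ((1 + (A * c₁)⁻¹ ^ a) * (A ^ a * w ^ a)) + M * (1 + h₀⁻¹ ^ η)) :=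
        mul_le_mul hAσ hsum hsum0 (Real.rpow_nonneg hA0.le _)
    _ ≤ A ^ a * (η * ((1 + (A * c₁)⁻¹ ^ a) * (A ^ a * w ^ a)) + M * (1 + h₀⁻¹ ^ η) * (c₁⁻¹ ^ a * w ^ a)) :=
        mul_le_mul_of_nonneg_left (add_le_add le_rfl (le_mul_of_one_le_right (mul_nonneg hM0 hK2) h3)) (Real.rpow_nonneg hA0.le _)
    _ = _ := by ring

/-! ## §2 The spherical series at a real exponent: positivity and smear -/

section CM

variable (L : Type) [Field L] [NumberField L] [IsCMField L]

/-- `E(φ₀H^z) = φ₀·E(H^z)` (`tsum` is homogeneous). [folklore] -/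
theorem eisensteinSeriesU_flatSectionU_const (φ₀ z : ℂ) (g : (quasiSplit (↥(maximalRealSubfield L)) L (IsCMField.complexConj L) 2).Adelic) :
    eisensteinSeriesU (flatSectionU (fun _ : (quasiSplit (↥(maximalRealSubfield L)) L (IsCMField.complexConj L) 2).Adelic => φ₀) z) g = φ₀ * eisensteinSeriesU (flatSectionU (fun _ : (quasiSplit (↥(maximalRealSubfield L)) L (IsCMField.complexConj L) 2).Adelic => (1 : ℂ)) z) g := by
  rw [eisensteinSeriesU_flatSectionU, eisensteinSeriesU_flatSectionU, ← tsum_mul_left]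
  simp only [one_mul]

/-- **`E(H^σ)(g) = ↑(Σ_q H(γ̃_q g)^σ)`** for a REAL exponent `σ`: the spherical series is a series of non-negative reals. [cite: MoeglinWaldspurger1995, II.1.5] -/
theorem eisensteinSeriesU_flatSectionU_one_ofReal (σ : ℝ) (g : (quasiSplit (↥(maximalRealSubfield L)) L (IsCMField.complexConj L) 2).Adelic) :
    eisensteinSeriesU (flatSectionU (fun _ : (quasiSplit (↥(maximalRealSubfield L)) L (IsCMField.complexConj L) 2).Adelic => (1 : ℂ)) ((σ : ℝ) : ℂ)) g = (((∑' q : Quotient (MulAction.orbitRel ↥(borelU ((IsCMField.complexConj L : L ≃ₐ[↥(maximalRealSubfield L)] L) : L →+* L) ((StdForm.antidiagonal 2).over L)) ↥(unitaryGroupOfForm ((IsCMField.complexConj L : L ≃ₐ[↥(maximalRealSubfield L)] L) : L →+* L) ((StdForm.antidiagonal 2).over L))), ((borelHeight (((quasiSplit (↥(maximalRealSubfield L)) L (IsCMField.complexConj L) 2).toAdelic (Quotient.out q : ↥(unitaryGroupOfForm ((IsCMField.complexConj L : L ≃ₐ[↥(maximalRealSubfield L)] L) : L →+* L) ((StdForm.antidiagonal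 2).over L)))) * (g)) : ℝ)) ^ σ) : ℝ) : ℂ) := by
  rw [eisensteinSeriesU_flatSectionU, Complex.ofReal_tsum]
  refine tsum_congr fun q => ?_
  simp only [one_mul]
  exact (Complex.ofReal_cpow (NNReal.coe_nonneg _) _).symm

/-- `Σ_q H(γ̃_q g)^σ ≥ 0`. [folklore] -/
theorem tsum_borelHeight_rpow_nonneg (σ : ℝ) (g : (quasiSplit (↥(maximalRealSubfield L)) L (IsCMField.complexConj L) 2).Adelic) : 0 ≤ (∑' q : Quotient (MulAction.orbitRel ↥(borelU ((IsCMField.complexConj L : L ≃ₐ[↥(maximalRealSubfield L)] L) : L →+* L) ((StdForm.antidiagonal 2).over L)) ↥(unitaryGroupOfForm ((IsCMField.complexConj L : L ≃ₐ[↥(maximalRealSubfield L)] L) : L →+* L) ((StdForm.antidiagonal 2).over L))), ((borelHeight (((quasiSplit (↥(maximalRealSubfield L)) L (IsCMField.complexConj L) 2).toAdelic (Quotient.out q : ↥(unitaryGroupOfForm ((IsCMField.complexConj L : L ≃ₐ[↥(maximalRealSubfield L)] L) : L →+* L) ((StdForm.antidiagonal 2).over L)))) * (g)) : ℝ)) ^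 σ) :=
  tsum_nonneg fun _ => Real.rpow_nonneg (NNReal.coe_nonneg _) _

/-- **`‖E(φ₀H^σ)(g)‖ = ‖φ₀‖·Σ_q H(γ̃_q g)^σ`** for real `σ`. [cite: MoeglinWaldspurger1995, II.1.5] -/
theorem norm_eisensteinSeriesU_flatSectionU_const_ofReal (φ₀ : ℂ) (σ : ℝ) (g : (quasiSplit (↥(maximalRealSubfield L)) L (IsCMField.complexConj L) 2).Adelic) :
    ‖eisensteinSeriesU (flatSectionU (fun _ : (quasiSplit (↥(maximalRealSubfield L)) L (IsCMField.complexConj L) 2).Adelic => φ₀) ((σ : ℝ) : ℂ)) g‖ = ‖φ₀‖ * (∑' q : Quotient (MulAction.orbitRel ↥(borelU ((IsCMField.complexConj L : L ≃ₐ[↥(maximalRealSubfield L)] L) : L →+* L) ((StdForm.antidiagonal 2).over L)) ↥(unitaryGroupOfForm ((IsCMField.complexConj L : L ≃ₐ[↥(maximalRealSubfield L)] L) : L →+* L) ((StdForm.antidiagonal 2).over L))), ((borelHeight (((quasiSplit (↥(maximalRealSubfield L)) L (IsCMField.complexConj L) 2).toAdelic (Quotient.out q : ↥(unitaryGroupOfForm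 ((IsCMField.complexConj L : L ≃ₐ[↥(maximalRealSubfield L)] L) : L →+* L) ((StdForm.antidiagonal 2).over L)))) * (g)) : ℝ)) ^ σ) := by
  rw [eisensteinSeriesU_flatSectionU_const, norm_mul, eisensteinSeriesU_flatSectionU_one_ofReal, Complex.norm_real,
    Real.norm_of_nonneg (tsum_borelHeight_rpow_nonneg L σ g)]

/-- **SMEAR ⟹ COMPARISON OF THE POSITIVE SERIES**: if `H(x g) ≤ A·H(x g')` for all `x` then `Σ_q H(γ̃_q g)^σ ≤ A^σ·Σ_q H(γ̃_q g')^σ` (`σ > 1`; both series converge by ★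
Godement CM-two `summable_borelHeight_rpow_cm_two`). [cite: Garrett2018, §3.10 (proof of Cor. 3.10.2)] [cite: MoeglinWaldspurger1995, II.1.5] -/
theorem tsum_borelHeight_rpow_le_of_smear {σ : ℝ} (hσ : 1 < σ) {A : ℝ≥0} {g g' : (quasiSplit (↥(maximalRealSubfield L)) L (IsCMField.complexConj L) 2).Adelic} (h : ∀ x : (quasiSplit (↥(maximalRealSubfield L)) L (IsCMField.complexConj L) 2).Adelic, borelHeight (x * g) ≤ A * borelHeight (x * g')) :
    (∑' q : Quotient (MulAction.orbitRel ↥(borelU ((IsCMField.complexConj L : L ≃ₐ[↥(maximalRealSubfield L)] L) : L →+* L) ((StdForm.antidiagonal 2).over L)) ↥(unitaryGroupOfForm ((IsCMField.complexConj L : L ≃ₐ[↥(maximalRealSubfield L)] L) : L →+* L) ((StdForm.antidiagonal 2).over L))), ((borelHeight (((quasiSplit (↥(maximalRealSubfield L)) L (IsCMField.complexConj L) 2).toAdelic (Quotient.out q : ↥(unitaryGroupOfForm ((IsCMField.complexConj L : L ≃ₐ[↥(maximalRealSubfield L)] L) : L →+* L) ((StdForm.antidiagonal 2).over L)))) * (g))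 : ℝ)) ^ σ) ≤ (A : ℝ) ^ σ * (∑' q : Quotient (MulAction.orbitRel ↥(borelU ((IsCMField.complexConj L : L ≃ₐ[↥(maximalRealSubfield L)] L) : L →+* L) ((StdForm.antidiagonal 2).over L)) ↥(unitaryGroupOfForm ((IsCMField.complexConj L : L ≃ₐ[↥(maximalRealSubfield L)] L) : L →+* L) ((StdForm.antidiagonal 2).over L))), ((borelHeight (((quasiSplit (↥(maximalRealSubfield L)) L (IsCMField.complexConj L) 2).toAdelic (Quotient.out q : ↥(unitaryGroupOfForm ((IsCMField.complexConj L : L ≃ₐ[↥(maximalRealSubfield L)] L) : L →+* L) ((StdForm.antidiagonal 2).over L)))) * (g')) : ℝ)) ^ σ) := by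
  have hs := summable_borelHeight_rpow_cm_two L hσ g
  have hs' := summable_borelHeight_rpow_cm_two L hσ g'
  rw [← tsum_mul_left]
  refine hs.tsum_le_tsum (fun q => ?_) (hs'.mul_left _)
  rw [← Real.mul_rpow (NNReal.coe_nonneg A) (NNReal.coe_nonneg _)]
  exact Real.rpow_le_rpow (NNReal.coe_nonneg _) (by exact_mod_cast h _) (zero_le_one.trans hσ.le)

/-! ## §3 The compact smearing set of the ray `t = d(z_L(r), z_L(r)⁻¹)`, `r ≥ r₀` -/

/-- **THE COMPACT SMEARING SET OF THE RAY.**  For `r₀ > 0`, a compact `Kq ⊆ G(𝔸)` and a compact `W ⊆ N(𝔸)` there is ONE compact `C ⊇ Kq` of `G(𝔸) = U(J₂)(𝔸_{L⁺})` such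
that for every ray torus element `t = d(z_L(r), z_L(r)⁻¹)` with `r ≥ r₀`, every `k ∈ Kq` and every `u ∈ W`: `t·k = (u·t)·c` for some `c ∈ C` — namely `c = (t⁻¹ut)⁻¹·k`, where
`t⁻¹ u t` stays in a compact set by the TORUS CONTRACTION ON THE LINE ★ `exists_isCompact_torusConj_mem_two`, the root value `z_L(r)⁻² = (z_∞(r⁻²), 1)` running over the compact
segment `{(z_∞(s), 1) : 0 ≤ s ≤ r₀⁻²} ⊆ 𝔸_L` (★ `continuous_realToInfiniteAdele`). [cite: Rogawski1990, §2.2 (p. 13)] [cite: MoeglinWaldspurger1995, I.2.2] -/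
theorem exists_isCompact_smear_set_ray (r₀ : ℝ≥0ˣ) {Kq : Set (quasiSplit (↥(maximalRealSubfield L)) L (IsCMField.complexConj L) 2).Adelic} (hKq : IsCompact Kq) {W : Set ↥(adelicUnipotent (↥(maximalRealSubfield L)) L (IsCMField.complexConj L) 2)} (hW : IsCompact W) :
    ∃ C : Set (quasiSplit (↥(maximalRealSubfield L)) L (IsCMField.complexConj L) 2).Adelic, IsCompact C ∧ Kq ⊆ C ∧
      ∀ r : ℝ≥0ˣ, r₀ ≤ r → ∀ t : ↥(torusInBorel (↥(maximalRealSubfield L)) L (IsCMField.complexConj L) 2),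
        adelicVal (↥(maximalRealSubfield L)) L (IsCMField.complexConj L) 2 _ ((t : ↥(borelAdelic (↥(maximalRealSubfield L)) L (IsCMField.complexConj L) 2)) : (quasiSplit (↥(maximalRealSubfield L)) L (IsCMField.complexConj L) 2).Adelic) = glDiagonal 2 (AdeleRing (𝓞 L) L) ![posRealIdele L r, (posRealIdele L r)⁻¹] →
        ∀ k ∈ Kq, ∀ u ∈ W, ∃ c ∈ C, ((t : ↥(borelAdelic (↥(maximalRealSubfield L)) L (IsCMField.complexConj L) 2)) : (quasiSplit (↥(maximalRealSubfield L)) L (IsCMField.complexConj L) 2).Adelic) * k = (u : (quasiSplit (↥(maximalRealSubfield L)) L (IsCMField.complexConj L) 2).Adelic) * ((t : ↥(borelAdelic (↥(maximalRealSubfield L)) L (IsCMField.complexConj L) 2)) : (quasiSplit (↥(maximalRealSubfield L)) L (IsCMField.complexConj L) 2).Adelic) * c := by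
  -- the root values `z_L(r)⁻²`, `r ≥ r₀`, lie in the compact segment `R = {(z_∞(s), 1) : 0 ≤ s ≤ r₀⁻²}`
  obtain ⟨R, hRdef⟩ : ∃ R : Set (AdeleRing (𝓞 L) L),
      R = (fun s : ℝ => ((realToInfiniteAdele L s, (1 : FiniteAdeleRing (𝓞 L) L)) : AdeleRing (𝓞 L) L)) '' Icc 0 ((((r₀ : ℝ≥0) : ℝ))⁻¹ * (((r₀ : ℝ≥0) : ℝ))⁻¹) := ⟨_, rfl⟩
  have hRc : IsCompact R := by
    rw [hRdef]
    exact isCompact_Icc.image ((continuous_realToInfiniteAdele L).prodMk continuous_const)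
  obtain ⟨W', hW'c, hW'⟩ := exists_isCompact_torusConj_mem_two (F := ↥(maximalRealSubfield L)) (c := IsCMField.complexConj L) hW hRc
  refine ⟨(fun w : ↥(adelicUnipotent (↥(maximalRealSubfield L)) L (IsCMField.complexConj L) 2) => ((w : (quasiSplit (↥(maximalRealSubfield L)) L (IsCMField.complexConj L) 2).Adelic))⁻¹) '' W' * Kq ∪ Kq, ((hW'c.image (continuous_subtype_val.inv)).mul hKq).union hKq, subset_union_right, ?_⟩
  intro r hr t ht k hk u hu
  have h0 : (0 : ℝ) < ((r₀ : ℝ≥0) : ℝ) := by exact_mod_cast pos_iff_ne_zero.2 r₀.ne_zero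
  have hle : ((r₀ : ℝ≥0) : ℝ) ≤ ((r : ℝ≥0) : ℝ) := by exact_mod_cast Units.val_le_val.2 hr
  have htT : ((t : ↥(borelAdelic (↥(maximalRealSubfield L)) L (IsCMField.complexConj L) 2)) : (quasiSplit (↥(maximalRealSubfield L)) L (IsCMField.complexConj L) 2).Adelic) ∈ torusAdelic (↥(maximalRealSubfield L)) L (IsCMField.complexConj L) 2 := (mem_torusInBorel_iff _).1 t.2
  have hval : ((![posRealIdele L r, (posRealIdele L r)⁻¹] : Fin 2 → (AdeleRing (𝓞 L) L)ˣ) 0)⁻¹ * (![posRealIdele L r, (posRealIdele L r)⁻¹] : Fin 2 → (AdeleRing (𝓞 L) L)ˣ) 1 =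
      posRealIdele L (r⁻¹ * r⁻¹) := by
    simp only [Matrix.cons_val_zero, Matrix.cons_val_one, map_mul, map_inv]
  have hroot : ((((![posRealIdele L r, (posRealIdele L r)⁻¹] : Fin 2 → (AdeleRing (𝓞 L) L)ˣ) 0)⁻¹ * (![posRealIdele L r, (posRealIdele L r)⁻¹] : Fin 2 → (AdeleRing (𝓞 L) L)ˣ) 1 :
      (AdeleRing (𝓞 L) L)ˣ) : AdeleRing (𝓞 L) L) ∈ R := by
    rw [hval, hRdef]
    refine ⟨(((r⁻¹ * r⁻¹ : ℝ≥0ˣ) : ℝ≥0) : ℝ), ⟨NNReal.coe_nonneg _, ?_⟩, Prod.ext (posRealIdele_fst L _).symm (posRealIdele_snd L _).symm⟩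
    rw [Units.val_mul, Units.val_inv_eq_inv_val, NNReal.coe_mul, NNReal.coe_inv]
    exact mul_le_mul (inv_anti₀ h0 hle) (inv_anti₀ h0 hle) (inv_nonneg.2 (h0.le.trans hle)) (inv_nonneg.2 h0.le)
  have hmem := hW' _ htT _ ht.symm hroot u hu
  refine ⟨((⟨((t : ↥(borelAdelic (↥(maximalRealSubfield L)) L (IsCMField.complexConj L) 2)) : (quasiSplit (↥(maximalRealSubfield L)) L (IsCMField.complexConj L) 2).Adelic)⁻¹ * (u : (quasiSplit (↥(maximalRealSubfield L)) L (IsCMField.complexConj L) 2).Adelic) * ((t : ↥(borelAdelic (↥(maximalRealSubfield L)) L (IsCMField.complexConj L) 2)) : (quasiSplit (↥(maximalRealSubfield L)) L (IsCMField.complexConj L) 2).Adelic), conj_mem_adelicUnipotent (torusAdelic_le_borelAdelic htT) u.2⟩ : ↥(adelicUnipotent (↥(maximalRealSubfield L)) L (IsCMField.complexConj L) 2)) : (quasiSplit (↥(maximalRealSubfield L)) L (IsCMField.complexConj L) 2).Adelic)⁻¹ * k,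
    Set.mem_union_left _ (Set.mul_mem_mul ⟨_, hmem, rfl⟩ hk), ?_⟩
  change ((t : ↥(borelAdelic (↥(maximalRealSubfield L)) L (IsCMField.complexConj L) 2)) : (quasiSplit (↥(maximalRealSubfield L)) L (IsCMField.complexConj L) 2).Adelic) * k = (u : (quasiSplit (↥(maximalRealSubfield L)) L (IsCMField.complexConj L) 2).Adelic) * ((t : ↥(borelAdelic (↥(maximalRealSubfield L)) L (IsCMField.complexConj L) 2)) : (quasiSplit (↥(maximalRealSubfield L)) L (IsCMField.complexConj L) 2).Adelic) * ((((t : ↥(borelAdelic (↥(maximalRealSubfield L)) L (IsCMField.complexConj L) 2)) : (quasiSplit (↥(maximalRealSubfield L)) L (IsCMField.complexConj L) 2).Adelic)⁻¹ * (u : (quasiSplit (↥(maximalRealSubfield L)) L (IsCMField.complexConj L) 2).Adelic) * ((t : ↥(borelAdelic (↥(maximalRealSubfield L)) L (IsCMField.complexConj L) 2)) : (quasiSplit (↥(maximalRealSubfield L)) L (IsCMField.complexConj L) 2).Adelic))⁻¹ * k)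
  group

/-! ## §4 The average over `𝓕` and the head -/

variable [MeasurableSpace (quasiSplit (↥(maximalRealSubfield L)) L (IsCMField.complexConj L) 2).Adelic] [BorelSpace (quasiSplit (↥(maximalRealSubfield L)) L (IsCMField.complexConj L) 2).Adelic]

/-- **THE AVERAGE OVER `𝓕`: `Σ_q H(γ̃_q g)^σ ≤ A^σ·(H(t)^σ + ‖c(σ)‖·H(t)^{1−σ})`** whenever `H(x g) ≤ A·H(x·u t)` for all `x ∈ G(𝔸)` and all `u` in a fundamental domain `𝓕` of
`N(L⁺)∖N(𝔸)` with compact closure, and the constant term of `E(H^σ)` along `N` at `t` is `H(t)^σ + c(σ)·H(t)^{1−σ}` (★ p858453 §1 ∘ ★ W5-B): the positive series at `g` is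
dominated termwise by the one at `u t` for EVERY `u ∈ 𝓕` (§2), hence by its `ν`-average over `𝓕`, i.e. by `A^σ` times the constant term (integrability on `𝓕` from the continuity of
`E(H^σ)` ★ `continuous_eisensteinSeriesU_flatSectionU_cm_two` on the compact `𝓕̄`). [cite: MoeglinWaldspurger1995, II.1.5 and II.1.7] [cite: Garrett2018, §2.8] -/
theorem tsum_borelHeight_rpow_le_of_borelConstantTerm (ν : Measure ↥(adelicUnipotent (↥(maximalRealSubfield L)) L (IsCMField.complexConj L) 2)) [ν.IsHaarMeasure] {𝓕 : Set ↥(adelicUnipotent (↥(maximalRealSubfield L)) L (IsCMField.complexConj L) 2)} (h𝓕N : IsFundamentalDomain ↥(rationalUnipotent (↥(maximalRealSubfield L)) L (IsCMField.complexConj L) 2) 𝓕 ν) (h𝓕c : IsCompact (closure 𝓕))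
    {σ : ℝ} (hσ : 1 < σ) {cσ : ℂ} {t g : (quasiSplit (↥(maximalRealSubfield L)) L (IsCMField.complexConj L) 2).Adelic} {A : ℝ≥0}
    (hCT : borelConstantTerm ν 𝓕 (eisensteinSeriesU (flatSectionU (fun _ : (quasiSplit (↥(maximalRealSubfield L)) L (IsCMField.complexConj L) 2).Adelic => (1 : ℂ)) ((σ : ℝ) : ℂ))) t = 1 * ((((borelHeight t : ℝ)) : ℂ) ^ ((σ : ℝ) : ℂ) + cσ * (((borelHeight t : ℝ)) : ℂ) ^ (1 - ((σ : ℝ) : ℂ))))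
    (hsm : ∀ u ∈ 𝓕, ∀ x : (quasiSplit (↥(maximalRealSubfield L)) L (IsCMField.complexConj L) 2).Adelic, borelHeight (x * g) ≤ A * borelHeight (x * ((u : (quasiSplit (↥(maximalRealSubfield L)) L (IsCMField.complexConj L) 2).Adelic) * t))) :
    (∑' q : Quotient (MulAction.orbitRel ↥(borelU ((IsCMField.complexConj L : L ≃ₐ[↥(maximalRealSubfield L)] L) : L →+* L) ((StdForm.antidiagonal 2).over L)) ↥(unitaryGroupOfForm ((IsCMField.complexConj L : L ≃ₐ[↥(maximalRealSubfield L)] L) : L →+* L) ((StdForm.antidiagonal 2).over L))), ((borelHeight (((quasiSplit (↥(maximalRealSubfield L)) L (IsCMField.complexConj L) 2).toAdelic (Quotient.out q : ↥(unitaryGroupOfForm ((IsCMField.complexConj L : L ≃ₐ[↥(maximalRealSubfield L)] L) : L →+* L) ((StdForm.antidiagonal 2).over L)))) * (g)) : ℝ)) ^ σ) ≤ (A : ℝ) ^ σ * ((borelHeight t : ℝ) ^ σ + ‖cσ‖ * (borelHeight t : ℝ) ^ (1 - σ)) := by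
  haveI := t2Space_adeleRing_of_numberField L
  haveI := locallyCompactSpace_adeleRing' L
  haveI : T2Space (quasiSplit (↥(maximalRealSubfield L)) L (IsCMField.complexConj L) 2).Adelic := inferInstanceAs (T2Space (adelic (↥(maximalRealSubfield L)) L (IsCMField.complexConj L) 2 ((StdForm.antidiagonal 2).over L)))
  have h𝓕₀ : ν 𝓕 ≠ 0 := measure_ne_zero_of_isFundamentalDomain_rationalUnipotent ν h𝓕N
  have h𝓕top : ν 𝓕 ≠ ∞ := ((measure_mono subset_closure).trans_lt h𝓕c.measure_lt_top).ne
  have hν : 0 < (ν 𝓕).toReal := ENNReal.toReal_pos h𝓕₀ h𝓕top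
  have hHt : 0 < (borelHeight t : ℝ) := by exact_mod_cast borelHeight_pos t
  -- continuity of the positive series along the fibre `𝓕·t`, integrability on `𝓕`
  have hz : (1 : ℝ) < (((σ : ℝ) : ℂ)).re := by rwa [Complex.ofReal_re]
  have hcontE : Continuous fun y : (quasiSplit (↥(maximalRealSubfield L)) L (IsCMField.complexConj L) 2).Adelic => eisensteinSeriesU (flatSectionU (fun _ : (quasiSplit (↥(maximalRealSubfield L)) L (IsCMField.complexConj L) 2).Adelic => (1 : ℂ)) ((σ : ℝ) : ℂ)) y :=
    continuous_eisensteinSeriesU_flatSectionU_cm_two L hz continuous_const (M := 1) (fun _ => by rw [norm_one])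
  have hSE : ∀ y : (quasiSplit (↥(maximalRealSubfield L)) L (IsCMField.complexConj L) 2).Adelic, eisensteinSeriesU (flatSectionU (fun _ : (quasiSplit (↥(maximalRealSubfield L)) L (IsCMField.complexConj L) 2).Adelic => (1 : ℂ)) ((σ : ℝ) : ℂ)) y = (((∑' q : Quotient (MulAction.orbitRel ↥(borelU ((IsCMField.complexConj L : L ≃ₐ[↥(maximalRealSubfield L)] L) : L →+* L) ((StdForm.antidiagonal 2).over L)) ↥(unitaryGroupOfForm ((IsCMField.complexConj L : L ≃ₐ[↥(maximalRealSubfield L)] L) : L →+* L) ((StdForm.antidiagonal 2).over L))), ((borelHeight (((quasiSplit (↥(maximalRealSubfield L)) L (IsCMField.complexConj L) 2).toAdelic (Quotient.out q : ↥(unitaryGroupOfForm ((IsCMField.complexConj L : L ≃ₐ[↥(maximalRealSubfield L)] L) : L →+* L) ((StdForm.antidiagonal 2).over L)))) * (y)) : ℝ)) ^ σ) : ℝ) : ℂ) := fun y => eisensteinSeriesU_flatSectionU_one_ofReal L σ y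
  have hcontS : Continuous fun u : ↥(adelicUnipotent (↥(maximalRealSubfield L)) L (IsCMField.complexConj L) 2) => (∑' q : Quotient (MulAction.orbitRel ↥(borelU ((IsCMField.complexConj L : L ≃ₐ[↥(maximalRealSubfield L)] L) : L →+* L) ((StdForm.antidiagonal 2).over L)) ↥(unitaryGroupOfForm ((IsCMField.complexConj L : L ≃ₐ[↥(maximalRealSubfield L)] L) : L →+* L) ((StdForm.antidiagonal 2).over L))), ((borelHeight (((quasiSplit (↥(maximalRealSubfield L)) L (IsCMField.complexConj L) 2).toAdelic (Quotient.out q : ↥(unitaryGroupOfForm ((IsCMField.complexConj L : L ≃ₐ[↥(maximalRealSubfield L)] L) : L →+* L) ((StdForm.antidiagonal 2).over L)))) * ((u : (quasiSplit (↥(maximalRealSubfield L)) L (IsCMField.complexConj L) 2).Adelic) * t)) : ℝ)) ^ σ) := by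
    have hfun : (fun u : ↥(adelicUnipotent (↥(maximalRealSubfield L)) L (IsCMField.complexConj L) 2) => (∑' q : Quotient (MulAction.orbitRel ↥(borelU ((IsCMField.complexConj L : L ≃ₐ[↥(maximalRealSubfield L)] L) : L →+* L) ((StdForm.antidiagonal 2).over L)) ↥(unitaryGroupOfForm ((IsCMField.complexConj L : L ≃ₐ[↥(maximalRealSubfield L)] L) : L →+* L) ((StdForm.antidiagonal 2).over L))), ((borelHeight (((quasiSplit (↥(maximalRealSubfield L)) L (IsCMField.complexConj L) 2).toAdelic (Quotient.out q : ↥(unitaryGroupOfForm ((IsCMField.complexConj L : L ≃ₐ[↥(maximalRealSubfield L)] L) : L →+* L) ((StdForm.antidiagonal 2).over L)))) * ((u : (quasiSplit (↥(maximalRealSubfield L)) L (IsCMField.complexConj L) 2).Adelic) * t)) : ℝ)) ^ σ)) = fun u : ↥(adelicUnipotent (↥(maximalRealSubfield L)) L (IsCMField.complexConj L) 2) => (eisensteinSeriesU (flatSectionU (fun _ : (quasiSplit (↥(maximalRealSubfield L)) L (IsCMField.complexConj L) 2).Adelic => (1 : ℂ)) ((σ : ℝ) : ℂ)) ((u : (quasiSplit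 (↥(maximalRealSubfield L)) L (IsCMField.complexConj L) 2).Adelic) * t)).re := by
      funext u
      rw [hSE, Complex.ofReal_re]
    rw [hfun]
    exact Complex.continuous_re.comp (hcontE.comp (continuous_subtype_val.mul continuous_const))
  have hint : IntegrableOn (fun u : ↥(adelicUnipotent (↥(maximalRealSubfield L)) L (IsCMField.complexConj L) 2) => (∑' q : Quotient (MulAction.orbitRel ↥(borelU ((IsCMField.complexConj L : L ≃ₐ[↥(maximalRealSubfield L)] L) : L →+* L) ((StdForm.antidiagonal 2).over L)) ↥(unitaryGroupOfForm ((IsCMField.complexConj L : L ≃ₐ[↥(maximalRealSubfield L)] L) : L →+* L) ((StdForm.antidiagonal 2).over L))), ((borelHeight (((quasiSplit (↥(maximalRealSubfield L)) L (IsCMField.complexConj L) 2).toAdelic (Quotient.out q : ↥(unitaryGroupOfForm ((IsCMField.complexConj L : L ≃ₐ[↥(maximalRealSubfield L)] L) : L →+* L) ((StdForm.antidiagonal 2).over L)))) * ((u : (quasiSplit (↥(maximalRealSubfield L)) L (IsCMField.complexConj L) 2).Adelic) * t)) : ℝ)) ^ σ)) 𝓕 ν :=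
    (hcontS.continuousOn.integrableOn_compact h𝓕c).mono_set subset_closure
  -- integrate the termwise comparison `S(g) ≤ A^σ·S(u t)` (§2) over `u ∈ 𝓕`
  have hpt : ∀ u ∈ 𝓕, (∑' q : Quotient (MulAction.orbitRel ↥(borelU ((IsCMField.complexConj L : L ≃ₐ[↥(maximalRealSubfield L)] L) : L →+* L) ((StdForm.antidiagonal 2).over L)) ↥(unitaryGroupOfForm ((IsCMField.complexConj L : L ≃ₐ[↥(maximalRealSubfield L)] L) : L →+* L) ((StdForm.antidiagonal 2).over L))), ((borelHeight (((quasiSplit (↥(maximalRealSubfield L)) L (IsCMField.complexConj L) 2).toAdelic (Quotient.out q : ↥(unitaryGroupOfForm ((IsCMField.complexConj L : L ≃ₐ[↥(maximalRealSubfield L)] L) : L →+* L) ((StdForm.antidiagonal 2).over L)))) * (g)) : ℝ)) ^ σ) ≤ (A : ℝ) ^ σ * (∑' q : Quotient (MulAction.orbitRel ↥(borelU ((IsCMField.complexConj L : L ≃ₐ[↥(maximalRealSubfield L)] L) : L →+* L) ((StdForm.antidiagonal 2).over L)) ↥(unitaryGroupOfForm ((IsCMField.complexConj L : L ≃ₐ[↥(maximalRealSubfield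 L)] L) : L →+* L) ((StdForm.antidiagonal 2).over L))), ((borelHeight (((quasiSplit (↥(maximalRealSubfield L)) L (IsCMField.complexConj L) 2).toAdelic (Quotient.out q : ↥(unitaryGroupOfForm ((IsCMField.complexConj L : L ≃ₐ[↥(maximalRealSubfield L)] L) : L →+* L) ((StdForm.antidiagonal 2).over L)))) * ((u : (quasiSplit (↥(maximalRealSubfield L)) L (IsCMField.complexConj L) 2).Adelic) * t)) : ℝ)) ^ σ) := fun u hu => tsum_borelHeight_rpow_le_of_smear L hσ (hsm u hu)
  have hI : (∑' q : Quotient (MulAction.orbitRel ↥(borelU ((IsCMField.complexConj L : L ≃ₐ[↥(maximalRealSubfield L)] L) : L →+* L) ((StdForm.antidiagonal 2).over L)) ↥(unitaryGroupOfForm ((IsCMField.complexConj L : L ≃ₐ[↥(maximalRealSubfield L)] L) : L →+* L) ((StdForm.antidiagonal 2).over L))), ((borelHeight (((quasiSplit (↥(maximalRealSubfield L)) L (IsCMField.complexConj L) 2).toAdelic (Quotient.out q : ↥(unitaryGroupOfForm ((IsCMField.complexConj L : L ≃ₐ[↥(maximalRealSubfield L)] L) : L →+* L) ((StdForm.antidiagonal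 2).over L)))) * (g)) : ℝ)) ^ σ) * (ν 𝓕).toReal ≤ (A : ℝ) ^ σ * ∫ u in 𝓕, (∑' q : Quotient (MulAction.orbitRel ↥(borelU ((IsCMField.complexConj L : L ≃ₐ[↥(maximalRealSubfield L)] L) : L →+* L) ((StdForm.antidiagonal 2).over L)) ↥(unitaryGroupOfForm ((IsCMField.complexConj L : L ≃ₐ[↥(maximalRealSubfield L)] L) : L →+* L) ((StdForm.antidiagonal 2).over L))), ((borelHeight (((quasiSplit (↥(maximalRealSubfield L)) L (IsCMField.complexConj L) 2).toAdelic (Quotient.out q : ↥(unitaryGroupOfForm ((IsCMField.complexConj L : L ≃ₐ[↥(maximalRealSubfield L)] L) : L →+* L) ((StdForm.antidiagonal 2).over L)))) * ((u : (quasiSplit (↥(maximalRealSubfield L)) L (IsCMField.complexConj L) 2).Adelic) * t)) : ℝ)) ^ σ) ∂ν := by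
    have hconst : ∫ _ in 𝓕, (∑' q : Quotient (MulAction.orbitRel ↥(borelU ((IsCMField.complexConj L : L ≃ₐ[↥(maximalRealSubfield L)] L) : L →+* L) ((StdForm.antidiagonal 2).over L)) ↥(unitaryGroupOfForm ((IsCMField.complexConj L : L ≃ₐ[↥(maximalRealSubfield L)] L) : L →+* L) ((StdForm.antidiagonal 2).over L))), ((borelHeight (((quasiSplit (↥(maximalRealSubfield L)) L (IsCMField.complexConj L) 2).toAdelic (Quotient.out q : ↥(unitaryGroupOfForm ((IsCMField.complexConj L : L ≃ₐ[↥(maximalRealSubfield L)] L) : L →+* L) ((StdForm.antidiagonal 2).over L)))) * (g)) : ℝ)) ^ σ) ∂ν = (∑' q : Quotient (MulAction.orbitRel ↥(borelU ((IsCMField.complexConj L : L ≃ₐ[↥(maximalRealSubfield L)] L) : L →+* L) ((StdForm.antidiagonal 2).over L)) ↥(unitaryGroupOfForm ((IsCMField.complexConj L : L ≃ₐ[↥(maximalRealSubfield L)] L) : L →+* L) ((StdForm.antidiagonal 2).over L))), ((borelHeight (((quasiSplit (↥(maximalRealSubfield L)) L (IsCMField.complexConj L) 2).toAdelic (Quotient.out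 q : ↥(unitaryGroupOfForm ((IsCMField.complexConj L : L ≃ₐ[↥(maximalRealSubfield L)] L) : L →+* L) ((StdForm.antidiagonal 2).over L)))) * (g)) : ℝ)) ^ σ) * (ν 𝓕).toReal := by
      rw [setIntegral_const, measureReal_def, smul_eq_mul, mul_comm]
    rw [← hconst, ← integral_const_mul]
    exact integral_mono_ae (integrableOn_const h𝓕top) (hint.const_mul _) ((ae_restrict_iff'₀ h𝓕N.nullMeasurableSet).2 (Eventually.of_forall hpt))
  -- the `ν`-average over `𝓕` IS the constant term: `(ν𝓕)⁻¹·∫_𝓕 S(u t) dν = H(t)^σ + c(σ)·H(t)^{1−σ}` (an identity in `ℂ`)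
  have hCT2 : borelConstantTerm ν 𝓕 (eisensteinSeriesU (flatSectionU (fun _ : (quasiSplit (↥(maximalRealSubfield L)) L (IsCMField.complexConj L) 2).Adelic => (1 : ℂ)) ((σ : ℝ) : ℂ))) t = (((borelHeight t : ℝ)) : ℂ) ^ ((σ : ℝ) : ℂ) + cσ * (((borelHeight t : ℝ)) : ℂ) ^ (1 - ((σ : ℝ) : ℂ)) := by
    rw [hCT, one_mul]
  have hCT' : (((ν 𝓕).toReal⁻¹ : ℝ)) • (((∫ u in 𝓕, (∑' q : Quotient (MulAction.orbitRel ↥(borelU ((IsCMField.complexConj L : L ≃ₐ[↥(maximalRealSubfield L)] L) : L →+* L) ((StdForm.antidiagonal 2).over L)) ↥(unitaryGroupOfForm ((IsCMField.complexConj L : L ≃ₐ[↥(maximalRealSubfield L)] L) : L →+* L) ((StdForm.antidiagonal 2).over L))), ((borelHeight (((quasiSplit (↥(maximalRealSubfield L)) L (IsCMField.complexConj L) 2).toAdelic (Quotient.out q : ↥(unitaryGroupOfForm ((IsCMField.complexConj L : L ≃ₐ[↥(maximalRealSubfield L)] L) : L →+* L) ((StdForm.antidiagonal 2).over L)))) *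 ((u : (quasiSplit (↥(maximalRealSubfield L)) L (IsCMField.complexConj L) 2).Adelic) * t)) : ℝ)) ^ σ) ∂ν : ℝ)) : ℂ) =
      (((borelHeight t : ℝ)) : ℂ) ^ ((σ : ℝ) : ℂ) + cσ * (((borelHeight t : ℝ)) : ℂ) ^ (1 - ((σ : ℝ) : ℂ)) := by
    rw [← hCT2, borelConstantTerm_def, ← integral_complex_ofReal]
    simp_rw [hSE]
  have hnorm : (ν 𝓕).toReal⁻¹ * ∫ u in 𝓕, (∑' q : Quotient (MulAction.orbitRel ↥(borelU ((IsCMField.complexConj L : L ≃ₐ[↥(maximalRealSubfield L)] L) : L →+* L) ((StdForm.antidiagonal 2).over L)) ↥(unitaryGroupOfForm ((IsCMField.complexConj L : L ≃ₐ[↥(maximalRealSubfield L)] L) : L →+* L) ((StdForm.antidiagonal 2).over L))), ((borelHeight (((quasiSplit (↥(maximalRealSubfield L)) L (IsCMField.complexConj L) 2).toAdelic (Quotient.out q : ↥(unitaryGroupOfForm ((IsCMField.complexConj L : L ≃ₐ[↥(maximalRealSubfield L)] L) : L →+* L) ((StdForm.antidiagonal 2).over L)))) * ((u : (quasiSplit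 (↥(maximalRealSubfield L)) L (IsCMField.complexConj L) 2).Adelic) * t)) : ℝ)) ^ σ) ∂ν ≤ (borelHeight t : ℝ) ^ σ + ‖cσ‖ * (borelHeight t : ℝ) ^ (1 - σ) := by
    have hre : (((σ : ℝ) : ℂ)).re = σ := Complex.ofReal_re σ
    have hre' : (1 - ((σ : ℝ) : ℂ)).re = 1 - σ := by rw [Complex.sub_re, Complex.one_re, Complex.ofReal_re]
    calc (ν 𝓕).toReal⁻¹ * ∫ u in 𝓕, (∑' q : Quotient (MulAction.orbitRel ↥(borelU ((IsCMField.complexConj L : L ≃ₐ[↥(maximalRealSubfield L)] L) : L →+* L) ((StdForm.antidiagonal 2).over L)) ↥(unitaryGroupOfForm ((IsCMField.complexConj L : L ≃ₐ[↥(maximalRealSubfield L)] L) : L →+* L) ((StdForm.antidiagonal 2).over L))), ((borelHeight (((quasiSplit (↥(maximalRealSubfield L)) L (IsCMField.complexConj L) 2).toAdelic (Quotient.out q : ↥(unitaryGroupOfForm ((IsCMField.complexConj L : L ≃ₐ[↥(maximalRealSubfield L)] L) : L →+* L) ((StdForm.antidiagonal 2).over L)))) * ((u : (quasiSplit (↥(maximalRealSubfield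 L)) L (IsCMField.complexConj L) 2).Adelic) * t)) : ℝ)) ^ σ) ∂ν
        ≤ ‖(((ν 𝓕).toReal⁻¹ : ℝ)) • (((∫ u in 𝓕, (∑' q : Quotient (MulAction.orbitRel ↥(borelU ((IsCMField.complexConj L : L ≃ₐ[↥(maximalRealSubfield L)] L) : L →+* L) ((StdForm.antidiagonal 2).over L)) ↥(unitaryGroupOfForm ((IsCMField.complexConj L : L ≃ₐ[↥(maximalRealSubfield L)] L) : L →+* L) ((StdForm.antidiagonal 2).over L))), ((borelHeight (((quasiSplit (↥(maximalRealSubfield L)) L (IsCMField.complexConj L) 2).toAdelic (Quotient.out q : ↥(unitaryGroupOfForm ((IsCMField.complexConj L : L ≃ₐ[↥(maximalRealSubfield L)] L) : L →+* L) ((StdForm.antidiagonal 2).over L)))) * ((u : (quasiSplit (↥(maximalRealSubfield L)) L (IsCMField.complexConj L) 2).Adelic) * t)) : ℝ)) ^ σ) ∂ν : ℝ)) : ℂ)‖ := by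
          rw [_root_.norm_smul, Real.norm_of_nonneg (inv_nonneg.2 hν.le), Complex.norm_real]
          exact mul_le_mul_of_nonneg_left (Real.le_norm_self _) (inv_nonneg.2 hν.le)
      _ = ‖(((borelHeight t : ℝ)) : ℂ) ^ ((σ : ℝ) : ℂ) + cσ * (((borelHeight t : ℝ)) : ℂ) ^ (1 - ((σ : ℝ) : ℂ))‖ := by rw [hCT']
      _ ≤ ‖(((borelHeight t : ℝ)) : ℂ) ^ ((σ : ℝ) : ℂ)‖ + ‖cσ * (((borelHeight t : ℝ)) : ℂ) ^ (1 - ((σ : ℝ) : ℂ))‖ := norm_add_le _ _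
      _ = (borelHeight t : ℝ) ^ σ + ‖cσ‖ * (borelHeight t : ℝ) ^ (1 - σ) := by
          rw [norm_mul, Complex.norm_cpow_eq_rpow_re_of_pos hHt, Complex.norm_cpow_eq_rpow_re_of_pos hHt, hre, hre']
  -- divide by `ν(𝓕) > 0`
  calc (∑' q : Quotient (MulAction.orbitRel ↥(borelU ((IsCMField.complexConj L : L ≃ₐ[↥(maximalRealSubfield L)] L) : L →+* L) ((StdForm.antidiagonal 2).over L)) ↥(unitaryGroupOfForm ((IsCMField.complexConj L : L ≃ₐ[↥(maximalRealSubfield L)] L) : L →+* L) ((StdForm.antidiagonal 2).over L))), ((borelHeight (((quasiSplit (↥(maximalRealSubfield L)) L (IsCMField.complexConj L) 2).toAdelic (Quotient.out q : ↥(unitaryGroupOfForm ((IsCMField.complexConj L : L ≃ₐ[↥(maximalRealSubfield L)] L) : L →+* L) ((StdForm.antidiagonal 2).over L)))) * (g)) : ℝ)) ^ σ) = (∑' q : Quotient (MulAction.orbitRel ↥(borelU ((IsCMField.complexConj L : L ≃ₐ[↥(maximalRealSubfield L)] L) : L →+* L) ((StdForm.antidiagonal 2).over L)) ↥(unitaryGroupOfForm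 ((IsCMField.complexConj L : L ≃ₐ[↥(maximalRealSubfield L)] L) : L →+* L) ((StdForm.antidiagonal 2).over L))), ((borelHeight (((quasiSplit (↥(maximalRealSubfield L)) L (IsCMField.complexConj L) 2).toAdelic (Quotient.out q : ↥(unitaryGroupOfForm ((IsCMField.complexConj L : L ≃ₐ[↥(maximalRealSubfield L)] L) : L →+* L) ((StdForm.antidiagonal 2).over L)))) * (g)) : ℝ)) ^ σ) * (ν 𝓕).toReal * (ν 𝓕).toReal⁻¹ := (mul_inv_cancel_right₀ hν.ne' _).symm
    _ ≤ (A : ℝ) ^ σ * (∫ u in 𝓕, (∑' q : Quotient (MulAction.orbitRel ↥(borelU ((IsCMField.complexConj L : L ≃ₐ[↥(maximalRealSubfield L)] L) : L →+* L) ((StdForm.antidiagonal 2).over L)) ↥(unitaryGroupOfForm ((IsCMField.complexConj L : L ≃ₐ[↥(maximalRealSubfield L)] L) : L →+* L) ((StdForm.antidiagonal 2).over L))), ((borelHeight (((quasiSplit (↥(maximalRealSubfield L)) L (IsCMField.complexConj L) 2).toAdelic (Quotient.out q : ↥(unitaryGroupOfForm ((IsCMField.complexConj L : L ≃ₐ[↥(maximalRealSubfield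 L)] L) : L →+* L) ((StdForm.antidiagonal 2).over L)))) * ((u : (quasiSplit (↥(maximalRealSubfield L)) L (IsCMField.complexConj L) 2).Adelic) * t)) : ℝ)) ^ σ) ∂ν) * (ν 𝓕).toReal⁻¹ := mul_le_mul_of_nonneg_right hI (inv_nonneg.2 hν.le)
    _ = (A : ℝ) ^ σ * ((ν 𝓕).toReal⁻¹ * ∫ u in 𝓕, (∑' q : Quotient (MulAction.orbitRel ↥(borelU ((IsCMField.complexConj L : L ≃ₐ[↥(maximalRealSubfield L)] L) : L →+* L) ((StdForm.antidiagonal 2).over L)) ↥(unitaryGroupOfForm ((IsCMField.complexConj L : L ≃ₐ[↥(maximalRealSubfield L)] L) : L →+* L) ((StdForm.antidiagonal 2).over L))), ((borelHeight (((quasiSplit (↥(maximalRealSubfield L)) L (IsCMField.complexConj L) 2).toAdelic (Quotient.out q : ↥(unitaryGroupOfForm ((IsCMField.complexConj L : L ≃ₐ[↥(maximalRealSubfield L)] L) : L →+* L) ((StdForm.antidiagonal 2).over L)))) * ((u : (quasiSplit (↥(maximalRealSubfield L)) L (IsCMField.complexConj L) 2).Adelic) * t)) : ℝ)) ^ σ)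 ∂ν) := by ring
    _ ≤ (A : ℝ) ^ σ * ((borelHeight t : ℝ) ^ σ + ‖cσ‖ * (borelHeight t : ℝ) ^ (1 - σ)) := mul_le_mul_of_nonneg_left hnorm (Real.rpow_nonneg (NNReal.coe_nonneg A) σ)

/-- **THE `(σ, g)`-UNIFORM MAJORANT OF `(σ − 1)·E(φ₀H^σ)(g)` NEAR THE POLE (road (ρ2) «G7 PROPER», file (R-b)).**  For the CM pair `(L⁺, L)`, `δ ∈ L⁻ ∖ 0`, a Haar measure `ν` of
`N(𝔸_{L⁺})`, a fundamental domain `𝓕` of `N(L⁺)` with compact closure (the binders of the capstone ★ `sphericalEisenstein_continuation_cm_two`), `φ₀ : ℂ` and ANY exponent `A > 1`: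
there are `η > 0` and `C ≥ 0` such that for every REAL `σ ∈ (1, 1 + η]` and EVERY `g ∈ U(J₂)(𝔸_{L⁺})`,
`(σ − 1)·‖E(φ₀H^σ)(g)‖ ≤ C·w₁(g)^A`, `w₁(g) = ⨆_{γ ∈ G(F)} H(γ g)` (finite, positive, `G(F)`-invariant ★).  On that interval the series converges, so this is a statement about the
series itself (`= Ẽ_g(σ)` there); the factor `σ − 1` absorbs the only pole `σ = 2ρ_H = 1`.  Proof: positivity `E(φ₀H^σ) = φ₀·E(H^σ)`, reduction ★ `exists_reduction_ray_cm`
(`γ₀ g = t k`) + automorphy ★, the compact smearing set of the ray (§3) + ★ smear ⇒ `E(H^σ)(t k) ≤ A₀^σ·E(H^σ)_B(t) = A₀^σ(H(t)^σ + c(σ)H(t)^{1−σ})` (§4's average ∘ ★ p858453 §1 ∘ ★ W5-B),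
`(σ−1)‖c(σ)‖ ≤ ‖r‖ + 1` near `1⁺` (★ W5-B residue), `H(t) ≥ r₀^{[L:ℚ]}H(1)`, `H(t) ≤ A₀·H(γ₀ g) ≤ A₀·w₁(g)`, `w₁ ≥ c₁ > 0` ★, bookkeeping `residue_majorant_arith`.
[cite: MoeglinWaldspurger1995, II.1.5 and IV.1.9] [cite: Garrett2018, §2.8 and §3.10] [cite: Godement1964, §8] -/
theorem residue_uniform_majorant_cm_two {δ : L} (hcδ : IsCMField.complexConj L δ = -δ) (hδ : δ ≠ 0)
    (ν : Measure ↥(adelicUnipotent (↥(maximalRealSubfield L)) L (IsCMField.complexConj L) 2)) [ν.IsHaarMeasure] {𝓕 : Set ↥(adelicUnipotent (↥(maximalRealSubfield L)) L (IsCMField.complexConj L) 2)} (h𝓕N : IsFundamentalDomain ↥(rationalUnipotent (↥(maximalRealSubfield L)) L (IsCMField.complexConj L) 2) 𝓕 ν) (h𝓕c : IsCompact (closure 𝓕)) (φ₀ : ℂ) {A : ℝ} (hA : 1 < A) :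
    ∃ η : ℝ, 0 < η ∧ ∃ C : ℝ, 0 ≤ C ∧ ∀ σ : ℝ, 1 < σ → σ ≤ 1 + η → ∀ g : (quasiSplit (↥(maximalRealSubfield L)) L (IsCMField.complexConj L) 2).Adelic,
      (σ - 1) * ‖eisensteinSeriesU (flatSectionU (fun _ : (quasiSplit (↥(maximalRealSubfield L)) L (IsCMField.complexConj L) 2).Adelic => φ₀) ((σ : ℝ) : ℂ)) g‖ ≤ C * (((⨆ γ : (quasiSplit (↥(maximalRealSubfield L)) L (IsCMField.complexConj L) 2).arithmeticSubgroup, borelHeight ((γ : (quasiSplit (↥(maximalRealSubfield L)) L (IsCMField.complexConj L) 2).Adelic) * g)) : ℝ≥0) : ℝ) ^ A := by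
  -- ★ W5-B: the constant-term function `c` with `(σ − 1)‖c(σ)‖ ≤ ‖r‖ + 1` on `(1, 1 + η₁)`
  obtain ⟨c, r, -, -, -, hcres, hceq⟩ := sphericalConstantTerm_continuation L hcδ hδ ν h𝓕N h𝓕c
  obtain ⟨η₁, hη₁, hM⟩ := exists_pos_forall_sub_one_mul_norm_le hcres
  -- ★ BL-R1: reduction to the ray; §3: the compact smearing set; ★ smear constant `A₀ ≥ 1`
  obtain ⟨r₀, Kq, hKq, hred⟩ := exists_reduction_ray_cm L
  obtain ⟨Cs, hCs, hKqCs, hfac⟩ := exists_isCompact_smear_set_ray L r₀ hKq h𝓕c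
  obtain ⟨A₀, hA₀, hsmear⟩ := exists_smear_borelHeight (fun g => exists_mem_borelAdelic_mul_mem_standardMaximalCompactGL_cm L g) hCs
  -- ★ BL-R1: `w₁ ≥ c₁ > 0`
  obtain ⟨c₁, hc₁, hw₁⟩ := exists_pos_forall_lt_ciSup_borelHeight_mul_cm L
  -- constants: the height floor `h₀` of the ray, the window `η`, the constant
  obtain ⟨h₀, hh₀def⟩ : ∃ h₀ : ℝ, h₀ = (((r₀ : ℝ≥0) : ℝ)) ^ Module.finrank ℚ L * (borelHeight (1 : (quasiSplit (↥(maximalRealSubfield L)) L (IsCMField.complexConj L) 2).Adelic) : ℝ) := ⟨_, rfl⟩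
  have hr₀ : (0 : ℝ) < ((r₀ : ℝ≥0) : ℝ) := by exact_mod_cast pos_iff_ne_zero.2 r₀.ne_zero
  have hh₀ : 0 < h₀ := by
    rw [hh₀def]
    exact mul_pos (pow_pos hr₀ _) (by exact_mod_cast borelHeight_pos (1 : (quasiSplit (↥(maximalRealSubfield L)) L (IsCMField.complexConj L) 2).Adelic))
  obtain ⟨η, hηdef⟩ : ∃ η : ℝ, η = min (η₁ / 2) (A - 1) := ⟨_, rfl⟩
  have hη : 0 < η := by rw [hηdef]; exact lt_min (half_pos hη₁) (sub_pos.2 hA)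
  have hηη₁ : η < η₁ := by rw [hηdef]; exact (min_le_left _ _).trans_lt (half_lt_self hη₁)
  have hηA : 1 + η ≤ A := by have h := min_le_right (η₁ / 2) (A - 1); rw [← hηdef] at h; linarith
  have hA₀' : (1 : ℝ) ≤ (A₀ : ℝ) := by exact_mod_cast hA₀
  have hc₁' : (0 : ℝ) < (c₁ : ℝ) := by exact_mod_cast hc₁
  have hK0 : 0 ≤ (A₀ : ℝ) ^ A * (η * (1 + ((A₀ : ℝ) * (c₁ : ℝ))⁻¹ ^ A) * (A₀ : ℝ) ^ A + (‖r‖ + 1) * (1 + h₀⁻¹ ^ η) * (c₁ : ℝ)⁻¹ ^ A) := by positivity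
  refine ⟨η, hη, ‖φ₀‖ * ((A₀ : ℝ) ^ A * (η * (1 + ((A₀ : ℝ) * (c₁ : ℝ))⁻¹ ^ A) * (A₀ : ℝ) ^ A + (‖r‖ + 1) * (1 + h₀⁻¹ ^ η) * (c₁ : ℝ)⁻¹ ^ A)),
    mul_nonneg (norm_nonneg _) hK0, fun σ hσ hση g => ?_⟩
  have hz : (1 : ℝ) < (((σ : ℝ) : ℂ)).re := by rwa [Complex.ofReal_re]
  -- reduce `g`: `γ₀ g = t k`, `k ∈ Kq`, `t` on the ray at `r ≥ r₀`
  obtain ⟨γ₀, rr, hrr, t, ht, -, hH, k, hk, hγg⟩ := hred g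
  -- automorphy: `E(φ₀H^σ)(g) = E(φ₀H^σ)(γ₀ g) = E(φ₀H^σ)(t k)`
  obtain ⟨γ', hγ'⟩ := MonoidHom.mem_range.1 γ₀.2
  have haut : eisensteinSeriesU (flatSectionU (fun _ : (quasiSplit (↥(maximalRealSubfield L)) L (IsCMField.complexConj L) 2).Adelic => φ₀) ((σ : ℝ) : ℂ)) g = eisensteinSeriesU (flatSectionU (fun _ : (quasiSplit (↥(maximalRealSubfield L)) L (IsCMField.complexConj L) 2).Adelic => φ₀) ((σ : ℝ) : ℂ)) (((t : ↥(borelAdelic (↥(maximalRealSubfield L)) L (IsCMField.complexConj L) 2)) : (quasiSplit (↥(maximalRealSubfield L)) L (IsCMField.complexConj L) 2).Adelic) * k) := by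
    have h := eisensteinSeriesU_flatSectionU_rational_mul (φ := fun _ : (quasiSplit (↥(maximalRealSubfield L)) L (IsCMField.complexConj L) 2).Adelic => φ₀) (fun _ _ _ => rfl) ((σ : ℝ) : ℂ) γ' g
    rw [← hγg, ← hγ', h]
  -- §3 + ★ smear: `H(x·t k) ≤ A₀·H(x·u t)` for every `u ∈ 𝓕 ⊆ 𝓕̄` and every `x`
  have hsm : ∀ u ∈ 𝓕, ∀ x : (quasiSplit (↥(maximalRealSubfield L)) L (IsCMField.complexConj L) 2).Adelic, borelHeight (x * (((t : ↥(borelAdelic (↥(maximalRealSubfield L)) L (IsCMField.complexConj L) 2)) : (quasiSplit (↥(maximalRealSubfield L)) L (IsCMField.complexConj L) 2).Adelic) * k)) ≤ A₀ * borelHeight (x * ((u : (quasiSplit (↥(maximalRealSubfield L)) L (IsCMField.complexConj L) 2).Adelic) * ((t : ↥(borelAdelic (↥(maximalRealSubfield L)) L (IsCMField.complexConj L) 2)) : (quasiSplit (↥(maximalRealSubfield L)) L (IsCMField.complexConj L) 2).Adelic))) := by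
    intro u hu x
    obtain ⟨c', hc', hfac'⟩ := hfac rr hrr t ht k hk u (subset_closure hu)
    rw [hfac', ← mul_assoc x]
    exact (hsmear _ c' hc').1
  -- ★ p858453 §1 ∘ ★ W5-B: the constant term of `E(H^σ)` at `t`
  have hCT : borelConstantTerm ν 𝓕 (eisensteinSeriesU (flatSectionU (fun _ : (quasiSplit (↥(maximalRealSubfield L)) L (IsCMField.complexConj L) 2).Adelic => (1 : ℂ)) ((σ : ℝ) : ℂ))) ((t : ↥(borelAdelic (↥(maximalRealSubfield L)) L (IsCMField.complexConj L) 2)) : (quasiSplit (↥(maximalRealSubfield L)) L (IsCMField.complexConj L) 2).Adelic) =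
      1 * ((((borelHeight ((t : ↥(borelAdelic (↥(maximalRealSubfield L)) L (IsCMField.complexConj L) 2)) : (quasiSplit (↥(maximalRealSubfield L)) L (IsCMField.complexConj L) 2).Adelic) : ℝ)) : ℂ) ^ ((σ : ℝ) : ℂ) + c ((σ : ℝ) : ℂ) * (((borelHeight ((t : ↥(borelAdelic (↥(maximalRealSubfield L)) L (IsCMField.complexConj L) 2)) : (quasiSplit (↥(maximalRealSubfield L)) L (IsCMField.complexConj L) 2).Adelic) : ℝ)) : ℂ) ^ (1 - ((σ : ℝ) : ℂ))) := by
    rw [hceq _ hz, borelConstantTerm_sphericalEisenstein_cm_two L ν h𝓕N h𝓕c 1 hz]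
  -- §4's average: `Σ_q H(γ̃_q t k)^σ ≤ A₀^σ (H(t)^σ + ‖c σ‖ H(t)^{1−σ})`
  have hS := tsum_borelHeight_rpow_le_of_borelConstantTerm L ν h𝓕N h𝓕c hσ hCT hsm
  -- heights: `h₀ ≤ H(t) ≤ A₀·H(t k) ≤ A₀·w₁(g)`, `c₁ ≤ w₁(g)`
  have hHt : h₀ ≤ (borelHeight ((t : ↥(borelAdelic (↥(maximalRealSubfield L)) L (IsCMField.complexConj L) 2)) : (quasiSplit (↥(maximalRealSubfield L)) L (IsCMField.complexConj L) 2).Adelic) : ℝ) := by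
    have h1 : borelHeight ((t : ↥(borelAdelic (↥(maximalRealSubfield L)) L (IsCMField.complexConj L) 2)) : (quasiSplit (↥(maximalRealSubfield L)) L (IsCMField.complexConj L) 2).Adelic) = ((rr : ℝ≥0)) ^ Module.finrank ℚ L * borelHeight (1 : (quasiSplit (↥(maximalRealSubfield L)) L (IsCMField.complexConj L) 2).Adelic) := by rw [← hH 1, mul_one]
    have hle : ((r₀ : ℝ≥0) : ℝ) ≤ ((rr : ℝ≥0) : ℝ) := by exact_mod_cast Units.val_le_val.2 hrr
    rw [hh₀def, h1, NNReal.coe_mul, NNReal.coe_pow]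
    exact mul_le_mul_of_nonneg_right (pow_le_pow_left₀ hr₀.le hle _) (NNReal.coe_nonneg _)
  have hHw : (borelHeight ((t : ↥(borelAdelic (↥(maximalRealSubfield L)) L (IsCMField.complexConj L) 2)) : (quasiSplit (↥(maximalRealSubfield L)) L (IsCMField.complexConj L) 2).Adelic) : ℝ) ≤ (A₀ : ℝ) * (((⨆ γ : (quasiSplit (↥(maximalRealSubfield L)) L (IsCMField.complexConj L) 2).arithmeticSubgroup, borelHeight ((γ : (quasiSplit (↥(maximalRealSubfield L)) L (IsCMField.complexConj L) 2).Adelic) * g)) : ℝ≥0) : ℝ) := by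
    have h1 : borelHeight ((t : ↥(borelAdelic (↥(maximalRealSubfield L)) L (IsCMField.complexConj L) 2)) : (quasiSplit (↥(maximalRealSubfield L)) L (IsCMField.complexConj L) 2).Adelic) ≤ A₀ * borelHeight (((t : ↥(borelAdelic (↥(maximalRealSubfield L)) L (IsCMField.complexConj L) 2)) : (quasiSplit (↥(maximalRealSubfield L)) L (IsCMField.complexConj L) 2).Adelic) * k) := (hsmear _ k (hKqCs hk)).2
    have h2 : borelHeight (((t : ↥(borelAdelic (↥(maximalRealSubfield L)) L (IsCMField.complexConj L) 2)) : (quasiSplit (↥(maximalRealSubfield L)) L (IsCMField.complexConj L) 2).Adelic) * k) ≤ (⨆ γ : (quasiSplit (↥(maximalRealSubfield L)) L (IsCMField.complexConj L) 2).arithmeticSubgroup, borelHeight ((γ : (quasiSplit (↥(maximalRealSubfield L)) L (IsCMField.complexConj L) 2).Adelic) * g)) := by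
      rw [← hγg]
      exact borelHeight_mul_le_ciSup γ₀ g
    exact_mod_cast h1.trans (mul_le_mul_of_nonneg_left h2 (by positivity))
  have hw : (c₁ : ℝ) ≤ (((⨆ γ : (quasiSplit (↥(maximalRealSubfield L)) L (IsCMField.complexConj L) 2).arithmeticSubgroup, borelHeight ((γ : (quasiSplit (↥(maximalRealSubfield L)) L (IsCMField.complexConj L) 2).Adelic) * g)) : ℝ≥0) : ℝ) := by exact_mod_cast (hw₁ g).le
  -- bookkeeping
  have key := residue_majorant_arith hσ hση hηA hA₀' hh₀ hHt hHw hc₁' hw (norm_nonneg (c ((σ : ℝ) : ℂ))) (hM σ hσ (by linarith))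
    hS
  rw [haut, norm_eisensteinSeriesU_flatSectionU_const_ofReal, mul_left_comm, mul_assoc ‖φ₀‖]
  exact mul_le_mul_of_nonneg_left key (norm_nonneg _)

/-- **THE MAJORANT, HEIGHT FORM** (all `g`): `(σ − 1)·‖E(φ₀H^σ)(g)‖ ≤ C·max(H(g), H(g)⁻¹)^A` — `w₁(g) ≤ max(H(g), H(g)⁻¹)` by the Siegel property ★ `borelHeight_toAdelic_mul_le_max_two`.
[cite: MoeglinWaldspurger1995, I.2.2 and II.1.5] [cite: Garrett2018, §2.3] -/
theorem residue_uniform_majorant_cm_two_le_max {δ : L} (hcδ : IsCMField.complexConj L δ = -δ) (hδ : δ ≠ 0)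
    (ν : Measure ↥(adelicUnipotent (↥(maximalRealSubfield L)) L (IsCMField.complexConj L) 2)) [ν.IsHaarMeasure] {𝓕 : Set ↥(adelicUnipotent (↥(maximalRealSubfield L)) L (IsCMField.complexConj L) 2)} (h𝓕N : IsFundamentalDomain ↥(rationalUnipotent (↥(maximalRealSubfield L)) L (IsCMField.complexConj L) 2) 𝓕 ν) (h𝓕c : IsCompact (closure 𝓕)) (φ₀ : ℂ) {A : ℝ} (hA : 1 < A) :
    ∃ η : ℝ, 0 < η ∧ ∃ C : ℝ, 0 ≤ C ∧ ∀ σ : ℝ, 1 < σ → σ ≤ 1 + η → ∀ g : (quasiSplit (↥(maximalRealSubfield L)) L (IsCMField.complexConj L) 2).Adelic,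
      (σ - 1) * ‖eisensteinSeriesU (flatSectionU (fun _ : (quasiSplit (↥(maximalRealSubfield L)) L (IsCMField.complexConj L) 2).Adelic => φ₀) ((σ : ℝ) : ℂ)) g‖ ≤ C * (max (borelHeight g : ℝ) (borelHeight g : ℝ)⁻¹) ^ A := by
  obtain ⟨η, hη, C, hC, h⟩ := residue_uniform_majorant_cm_two L hcδ hδ ν h𝓕N h𝓕c φ₀ hA
  refine ⟨η, hη, C, hC, fun σ hσ hση g => (h σ hσ hση g).trans (mul_le_mul_of_nonneg_left ?_ hC)⟩
  have hw : (⨆ γ : (quasiSplit (↥(maximalRealSubfield L)) L (IsCMField.complexConj L) 2).arithmeticSubgroup, borelHeight ((γ : (quasiSplit (↥(maximalRealSubfield L)) L (IsCMField.complexConj L) 2).Adelic) * g)) ≤ max (borelHeight g) (borelHeight g)⁻¹ := by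
    refine ciSup_le fun γ => ?_
    obtain ⟨γ', hγ'⟩ := MonoidHom.mem_range.1 γ.2
    rw [← hγ']
    exact borelHeight_toAdelic_mul_le_max_two γ' g
  have hw' : (((⨆ γ : (quasiSplit (↥(maximalRealSubfield L)) L (IsCMField.complexConj L) 2).arithmeticSubgroup, borelHeight ((γ : (quasiSplit (↥(maximalRealSubfield L)) L (IsCMField.complexConj L) 2).Adelic) * g)) : ℝ≥0) : ℝ) ≤ max (borelHeight g : ℝ) (borelHeight g : ℝ)⁻¹ := by exact_mod_cast hw
  exact Real.rpow_le_rpow (NNReal.coe_nonneg _) hw' (zero_le_one.trans hA.le)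

/-- **THE MAJORANT ON THE SIEGEL SET `{1 ≤ H}`** (the form of the deal): `(σ − 1)·‖E(φ₀H^σ)(g)‖ ≤ C·H(g)^A` for `σ ∈ (1, 1 + η]`, `H(g) ≥ 1`.
[cite: MoeglinWaldspurger1995, I.2.2 and II.1.5] [cite: Garrett2018, §2.8] -/
theorem residue_uniform_majorant_cm_two_siegel {δ : L} (hcδ : IsCMField.complexConj L δ = -δ) (hδ : δ ≠ 0)
    (ν : Measure ↥(adelicUnipotent (↥(maximalRealSubfield L)) L (IsCMField.complexConj L) 2)) [ν.IsHaarMeasure] {𝓕 : Set ↥(adelicUnipotent (↥(maximalRealSubfield L)) L (IsCMField.complexConj L) 2)} (h𝓕N : IsFundamentalDomain ↥(rationalUnipotent (↥(maximalRealSubfield L)) L (IsCMField.complexConj L) 2) 𝓕 ν) (h𝓕c : IsCompact (closure 𝓕)) (φ₀ : ℂ) {A : ℝ} (hA : 1 < A) :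
    ∃ η : ℝ, 0 < η ∧ ∃ C : ℝ, 0 ≤ C ∧ ∀ σ : ℝ, 1 < σ → σ ≤ 1 + η → ∀ g : (quasiSplit (↥(maximalRealSubfield L)) L (IsCMField.complexConj L) 2).Adelic, 1 ≤ borelHeight g →
      (σ - 1) * ‖eisensteinSeriesU (flatSectionU (fun _ : (quasiSplit (↥(maximalRealSubfield L)) L (IsCMField.complexConj L) 2).Adelic => φ₀) ((σ : ℝ) : ℂ)) g‖ ≤ C * (borelHeight g : ℝ) ^ A := by
  obtain ⟨η, hη, C, hC, h⟩ := residue_uniform_majorant_cm_two_le_max L hcδ hδ ν h𝓕N h𝓕c φ₀ hA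
  refine ⟨η, hη, C, hC, fun σ hσ hση g hg => ?_⟩
  have hg' : (1 : ℝ) ≤ (borelHeight g : ℝ) := by exact_mod_cast hg
  have hmax : max (borelHeight g : ℝ) (borelHeight g : ℝ)⁻¹ = (borelHeight g : ℝ) := max_eq_left ((inv_le_one_of_one_le₀ hg').trans hg')
  have h' := h σ hσ hση g
  rwa [hmax] at h'

end CM

end Summit.HodgeConjecture.HodgeConjecture.Cruxes.H413.K2E1ResidueUniformMajorantCMTwo

end
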